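import Literature.Probability.LatticeModels.RegularScales
import Literature.Probability.LatticeModels.DirInvCorrLength
import HarnessLib

/-!
# Abundance of regular scales (Aizenman–Duminil-Copin 2021, Theorem 5.12) for the four-dimensional Ising model

Topic `Literature/Probability/LatticeModels`; family `crit-ising` (crit-ising.S13). Theorems only: no
definition and no named fact is introduced. Proof companion of `RegularScales` (ADC Def. 5.11 and the
verification step `isRegularScale_of_growth`).

M. Aizenman, H. Duminil-Copin, *Marginal triviality of the scaling limits of critical 4D Ising and `φ⁴₄`
models*, Ann. of Math. **194** (2021) = arXiv:1912.07973, **Theorem 5.12** (Abundance of regular scales,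
p. 20): "Fix `d > 2` and `α > 2`. There exist `c = c(d) > 0` and `C = C(d) > 0` such that for every
n.n.f. model in the GS class and every `n^α ≤ N ≤ ξ(ρ,β)`, there are at least `c log₂(N/n)` regular scales
`k` with `n ≤ 2^k ≤ N`." Here for the nearest-neighbour Ising model on `ℤ⁴`, `S = ⟨σ₀σ_x⟩^∅_β`
(`= ⟨σ₀σ_x⟩_β`, the state being unique), `0 < β ≤ β_c`, with the window `N ≤ ξ(β)` written as in the
tree (`β = β_c`, or `N ξ(β)⁻¹ ≤ 1` with `ξ⁻¹ = invCorrLength (twoPointPlus 4 β)`):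

* Part E — the inputs of the printed proof in the window: `m*(β) = 0` (so that the gradient estimate
  applies and `⟨·⟩^∅ = ⟨·⟩⁺`), the sliding-scale infrared bound for `twoPointFree` (Thm 5.6, the tree
  theorem `aizenmanDuminilCopin_slidingScaleInfraredBound_holds` read on the free DLR state), the lower
  bound `χ_t ≥ θ t` for `t ≤ N` (`sphereSum_ge_of_window`, the printed "`χ_N ≥ c₀N`") and the infrared
  bound `χ_t ≤ C(t+1)²` (`exists_sum_box_twoPointFree_le_sq`);
* Part F — the count: `abundance_of_regularScales` (for every `α > 2` there are `c₀, C₀, c₁ > 0`, `C₁` with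
  `#{k : n ≤ 2^k ≤ N, k regular} ≥ c₁ log(N/n) - C₁` whenever `n ≥ 1`, `n^α ≤ N`, `N` in the window), by
  the pigeonhole `log_growth_le_card_mul_add` along the chain `m_i = 2^{k₀+6+iJ}` (`2^{k₀} > n`,
  `J ≍ (α-1)/(α-2)`), each growth scale being regular (`isRegularScale_of_growth`), and the real-variable
  endgame `count_endgame`; and the existence form `exists_regularScale_between` used in §6.

The constants depend on `α` (as in R. Panis, arXiv:2309.05797, Prop. 3.28); the additive `C₁` makes the
statement honest for `N/n` bounded, where the printed `c log₂(N/n)` is to be read as vacuous.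

## References

* M. Aizenman, H. Duminil-Copin, Ann. of Math. 194 (2021), arXiv:1912.07973, Thm 5.12 and its proof
  (p. 20), Thm 5.6 (p. 18), proof of Prop. 6.1 (p. 22) [AizenmanDuminilCopinAnnals2021].
* R. Panis, arXiv:2309.05797 (2023), Prop. 3.28 [Panis2023Triviality].

## Mathlib

`Nat.log`, `Nat.lt_pow_succ_log_self`, `Nat.pow_log_le_self`, `Nat.ceil`, `Real.log_rpow`,
`Finset.card_le_card_of_injOn`, `linarith`/`nlinarith`.
-/

noncomputable section

open MeasureTheory Filter Topology Finset

namespace Literature.Probability.LatticeModels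

variable {d : ℕ}

/-! ### Part E. The inputs of the four-dimensional model in the window `N ≤ ξ(β)` -/

section Window

variable {β : ℝ}

/-- `m*(β) = 0` for `0 ≤ β ≤ β_c(4)` (below `β_c` by definition of `β_c` and `m* ≥ 0`; at `β_c` by
Aizenman–Duminil-Copin–Sidoravicius 2015, the tree's `spontaneousMagnetization_criticalBeta_eq_zero_holds`).
[cite: AizenmanDuminilCopinSidoravicius2015, Thm. 1.1] -/
theorem spontaneousMagnetization_eq_zero_of_le_criticalBeta_four (hβ : 0 ≤ β) (hβc : β ≤ criticalBeta 4) :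
    spontaneousMagnetization 4 β = 0 := by
  rcases hβc.lt_or_eq with hlt | heq
  · exact le_antisymm
      (not_lt.1 fun hpos => not_le.2 hlt (csInf_le ⟨0, fun _ hb => hb.1⟩ ⟨hβ, hpos⟩))
      (spontaneousMagnetization_nonneg_holds (d := 4) hβ)
  · rw [heq]
    exact spontaneousMagnetization_criticalBeta_eq_zero_holds (d := 4) (by norm_num)

/-- `⟨σ₀σ_x⟩^∅_β = ⟨σ₀σ_x⟩⁺_β` on `ℤ⁴` for `0 ≤ β ≤ β_c` (Lebowitz–Martin-Löf, `m*(β) = 0`). [cite: LebowitzMartinlof1972, Theorem] -/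
theorem twoPointFree_eq_twoPointPlus_four (hβ : 0 ≤ β) (hβc : β ≤ criticalBeta 4) :
    twoPointFree 4 β = twoPointPlus 4 β :=
  funext fun x => twoPointFree_eq_twoPointPlus_of_spontaneousMagnetization_eq_zero hβ
    (spontaneousMagnetization_eq_zero_of_le_criticalBeta_four hβ hβc) x

/-- **The sliding-scale infrared bound for the free two-point function on `ℤ⁴`** (ADC Thm 5.6, the tree
theorem `aizenmanDuminilCopin_slidingScaleInfraredBound_holds`, read on the free DLR state, whose
two-point function is `twoPointFree`): `χ_L/L² ≤ (C/β) χ_ℓ/ℓ²` for `0 < β ≤ β_c`, `1 ≤ ℓ ≤ L`.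
[cite: AizenmanDuminilCopinAnnals2021, arXiv:1912.07973 Theorem 5.6 (p. 18)] -/
theorem slidingScale_twoPointFree_four : ∃ C : ℝ, 0 < C ∧ ∀ β : ℝ, 0 < β → β ≤ criticalBeta 4 →
    ∀ ℓ L : ℝ, 1 ≤ ℓ → ℓ ≤ L →
      boxSusceptibility (twoPointFree 4 β) L / L ^ 2 ≤
        C / β * (boxSusceptibility (twoPointFree 4 β) ℓ / ℓ ^ 2) := by
  obtain ⟨C, hC, H⟩ := aizenmanDuminilCopin_slidingScaleInfraredBound_holds (d := 4) (by norm_num)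
  refine ⟨C, hC, fun β hβ hβc ℓ L hℓ hℓL => ?_⟩
  obtain ⟨μ, hμ, -, -⟩ := exists_freeMeasure_holds 4 (β := β) 0 hβ.le le_rfl
  have htwo := (isingGibbsMeasure_twoPoint_of_facts hasUniqueGibbsMeasure_of_lt_criticalBeta_holds
    hasUniqueGibbsMeasure_criticalBeta_holds (fun d => exists_freeMeasure_holds d 0) (by norm_num)
    hβ.le hβc hμ).2
  have hS : twoPoint μ spinAt 0 = twoPointFree 4 β := by
    funext v
    exact (htwo 0 v).trans (by rw [sub_zero])
  have h := H β ℓ L hβ hβc hℓ hℓL μ hμ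
  rw [hS] at h
  exact h

/-- The doubling and scale-transfer forms of the sliding-scale bound at integer scales:
`χ_{Rm} ≤ (C/β) R² χ_m` for `R, m ≥ 1`. [cite: AizenmanDuminilCopinAnnals2021, arXiv:1912.07973 Theorem 5.6 (p. 18)] -/
theorem boxSusceptibility_mul_le_of_sliding {C : ℝ}
    (H : ∀ ℓ L : ℝ, 1 ≤ ℓ → ℓ ≤ L →
      boxSusceptibility (twoPointFree 4 β) L / L ^ 2 ≤ C * (boxSusceptibility (twoPointFree 4 β) ℓ / ℓ ^ 2))
    {R m : ℕ} (hR : 1 ≤ R) (hm : 1 ≤ m) :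
    boxSusceptibility (twoPointFree 4 β) ((R * m : ℕ) : ℝ) ≤
      C * (R : ℝ) ^ 2 * boxSusceptibility (twoPointFree 4 β) (m : ℝ) := by
  have hm' : (1 : ℝ) ≤ m := by exact_mod_cast hm
  have hR' : (1 : ℝ) ≤ R := by exact_mod_cast hR
  have h := H m ((R * m : ℕ) : ℝ) hm' (by push_cast; nlinarith)
  have hpos : (0 : ℝ) < ((R * m : ℕ) : ℝ) ^ 2 := by positivity
  rw [div_le_iff₀ hpos] at h
  refine h.trans (le_of_eq ?_)
  push_cast
  field_simp

/-- **Lower bound on `χ` in the window** (`d = 4`): for `0 < β ≤ β_c` and `2 ≤ N ≤ ξ(β)`,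
`χ_t ≥ θ t` for every `t ≤ N`, `θ = e^{-2}/(32 β_c)` (the tree's `sphereSum_ge_of_window`, i.e. the
Simon–Lieb lower bound on sphere sums, summed over the radii; the printed "`χ_N ≥ c₀ N`").
[cite: AizenmanDuminilCopinAnnals2021, arXiv:1912.07973 proof of Theorem 5.12, first display (p. 20)] -/
theorem boxSusceptibility_ge_of_window (hβ : 0 < β) (hβc : β ≤ criticalBeta 4) {N : ℕ} (hN : 2 ≤ N)
    (hwin : β = criticalBeta 4 ∨ (0 < β ∧ (N : ℝ) * invCorrLength (twoPointPlus 4 β) ≤ 1))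
    {t : ℕ} (ht : t ≤ N) :
    Real.exp (-2) / (32 * criticalBeta 4) * t ≤ boxSusceptibility (twoPointFree 4 β) (t : ℝ) := by
  have hpos : 0 < twoPointPlus 4 β (Pi.single 0 1) := twoPointPlus_single_pos hβ 0
  rw [twoPointFree_eq_twoPointPlus_four hβ.le hβc]
  refine mul_le_boxSusceptibility_of_sphereSum (fun x => (twoPointPlus_pos hβ x).le) fun n _ hn => ?_
  exact sphereSum_ge_of_window hβ hβc hN hwin hpos (hn.trans ht)

/-- **The infrared bound for `χ`** (`d = 4`): `χ_t ≤ C (t+1)²` for `0 ≤ β ≤ β_c`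
(`exists_sum_box_twoPointFree_le_sq`; the printed use of (5.23) in "`c₀ N ≥ … ≥ c₁ (N/n)^{…} χ_n`").
[cite: AizenmanDuminilCopinAnnals2021, arXiv:1912.07973 proof of Theorem 5.12, first display (p. 20)] -/
theorem boxSusceptibility_le_sq_four : ∃ C : ℝ, 0 < C ∧ ∀ β : ℝ, 0 ≤ β → β ≤ criticalBeta 4 → ∀ t : ℕ,
    boxSusceptibility (twoPointFree 4 β) (t : ℝ) ≤ C * ((t : ℝ) + 1) ^ 2 := by
  obtain ⟨C, hC, H⟩ := exists_sum_box_twoPointFree_le_sq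
  refine ⟨C, hC, fun β hβ hβc t => ?_⟩
  rw [boxSusceptibility_natCast]
  exact H β hβ hβc t

end Window

/-! ### Part F. The count (ADC Theorem 5.12 for the four-dimensional Ising model) -/

section Count

/-- **The real-variable endgame of the count.** With `X = log N`, `Y = log n` (`αY ≤ X`, `Y ≥ 0`),
`η = (α-2)/(α-1)`, `J ≥ 2/η`, the pigeonhole inequality
`(IJ - I - e₀ - 2) log 2 + A ≤ J log D · g` (`A = log θ - log C_IR`), the bounds `e₀ log 2 ≤ Y + 12 log 2`,
`IJ ≥ L - e₀ - (J-1)`, `L log 2 ≥ X - log 2` give `(η/2)(X - Y) - ((J+25) log 2 - A) ≤ J log D · g`.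
[cite: AizenmanDuminilCopinAnnals2021, arXiv:1912.07973 proof of Theorem 5.12 (p. 20)] -/
theorem count_endgame {α η Jr lD l2 X Y e0 Ir Lr g A : ℝ} (hα : 2 < α) (hη : η = (α - 2) / (α - 1))
    (hJ : 2 / η ≤ Jr) (hl2 : 0 < l2) (hY : 0 ≤ Y) (hXY : α * Y ≤ X)
    (hPC : (Ir * Jr - Ir - e0 - 2) * l2 + A ≤ Jr * lD * g) (he0 : e0 * l2 ≤ Y + 12 * l2)
    (hIJ : Lr - e0 - (Jr - 1) ≤ Ir * Jr) (hL : X - l2 ≤ Lr * l2) :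
    η / 2 * (X - Y) - ((Jr + 25) * l2 - A) ≤ Jr * lD * g := by
  have hα1 : 0 < α - 1 := by linarith
  have hη0 : 0 < η := by rw [hη]; exact div_pos (by linarith) hα1
  have hη1 : η < 1 := by rw [hη, div_lt_one hα1]; linarith
  have hJpos : 0 < Jr := lt_of_lt_of_le (div_pos two_pos hη0) hJ
  set u : ℝ := 1 / Jr with hu
  have hu0 : 0 < u := by rw [hu]; positivity
  have huη : u ≤ η / 2 := by
    rw [hu, div_le_iff₀ hJpos]
    rw [div_le_iff₀ hη0] at hJ
    linarith
  -- `I J l2 ≥ X - e0 l2 - J l2`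
  have h1 : X - e0 * l2 - Jr * l2 ≤ Ir * Jr * l2 := by
    have := mul_le_mul_of_nonneg_right hIJ hl2.le
    nlinarith
  -- `I (J-1) l2 = (1 - u) (I J l2) ≥ (1 - u)(X - e0 l2 - J l2)`
  have h1u : 0 ≤ 1 - u := by linarith [huη, hη1]
  have h2 : (1 - u) * (X - e0 * l2 - Jr * l2) ≤ (Ir * Jr - Ir) * l2 := by
    have h := mul_le_mul_of_nonneg_left h1 h1u
    have heq : (1 - u) * (Ir * Jr * l2) = (Ir * Jr - Ir) * l2 := by
      rw [hu]; field_simp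
    linarith [heq]
  -- the `α`-bracket is non-negative
  have hbr : 0 ≤ (1 - u - η / 2) * X - (2 - u - η / 2) * Y := by
    have hc0 : 0 ≤ 1 - u - η / 2 := by linarith
    have hkey : (1 - u - η / 2) * α - (2 - u - η / 2) = (α - 1) * (η / 2 - u) := by
      rw [hη]; field_simp; ring
    have hpos : 0 ≤ (α - 1) * (η / 2 - u) := mul_nonneg hα1.le (by linarith)
    calc (0 : ℝ) ≤ ((1 - u - η / 2) * α - (2 - u - η / 2)) * Y := by rw [hkey]; exact mul_nonneg hpos hY
      _ = (1 - u - η / 2) * (α * Y) - (2 - u - η / 2) * Y := by ring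
      _ ≤ (1 - u - η / 2) * X - (2 - u - η / 2) * Y := by
          linarith [mul_le_mul_of_nonneg_left hXY hc0]
  -- assemble
  have h3 : (2 - u) * (e0 * l2) ≤ (2 - u) * (Y + 12 * l2) :=
    mul_le_mul_of_nonneg_left he0 (by linarith [huη, hη1])
  have h4 : (1 - u) * Jr = Jr - 1 := by rw [hu]; field_simp
  nlinarith [hPC, h2, hbr, h3, h4, hl2, hu0]


/-- `χ_0 = 1` and `χ_t ≥ 1 > 0` for the free two-point function (`S ≥ 0`, `S(0) = 1`). [folklore] -/
theorem boxSusceptibility_twoPointFree_pos {β : ℝ} (hβ : 0 ≤ β) (t : ℕ) :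
    0 < boxSusceptibility (twoPointFree 4 β) (t : ℝ) := by
  have h1 : (1 : ℝ) ≤ boxSusceptibility (twoPointFree 4 β) ((0 : ℕ) : ℝ) := by
    rw [boxSusceptibility_natCast, sum_box_zero, twoPointFree_zero]
  exact lt_of_lt_of_le (zero_lt_one.trans_le h1)
    (boxSusceptibility_mono (twoPointFree_nonneg_of_nonneg hβ) (by exact_mod_cast Nat.zero_le t))

open scoped Classical in
/-- **Aizenman–Duminil-Copin 2021, Theorem 5.12 (abundance of regular scales), four-dimensional
nearest-neighbour Ising model.** For every `α > 2` there are regularity constants `c₀, C₀ > 0` and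
`c₁ > 0`, `C₁` such that for every `0 < β ≤ β_c`, every `n ≥ 1` and every `N ≥ n^α` in the window
`N ≤ ξ(β)` (`β = β_c`, or `N ξ(β)⁻¹ ≤ 1`), the number of `(c₀, C₀)`-regular scales `k` (Def. 5.11, for
`S = ⟨σ₀σ_x⟩^∅_β = ⟨σ₀σ_x⟩_β`) with `n ≤ 2^k ≤ N` is at least `c₁ log(N/n) - C₁`. (Printed: "at least
`c log₂(N/n)` regular scales `k` with `n ≤ 2^k ≤ N`"; the additive constant makes the count honest
for `N/n` in a bounded range, where the printed bound is to be read as vacuous, and the constants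
depend on `α` as in Panis 2023, Prop. 3.28.) Proof as printed: the lower bound `χ_N ≥ c₀N` (window)
and the infrared bound `χ_n ≤ C n²` force a logarithmic growth of `χ` between `n` and `N ≥ n^α`; by
the sliding-scale infrared bound (Thm 5.6) the growth is achieved at `≥ c log(N/n)` dyadic scales
`m` with `χ_{rm} ≥ χ_{32m} + χ_m` (`log_growth_le_card_mul_add`), each of which is regular
(`isRegularScale_of_growth`). [cite: AizenmanDuminilCopinAnnals2021, arXiv:1912.07973 Theorem 5.12 and its proof (p. 20)] [cite: Panis2023Triviality, Proposition 3.28 (p. 17)] -/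
theorem abundance_of_regularScales {α : ℝ} (hα : 2 < α) :
    ∃ c₀ C₀ c₁ C₁ : ℝ, 0 < c₀ ∧ 0 < C₀ ∧ 0 < c₁ ∧
      ∀ β : ℝ, 0 < β → β ≤ criticalBeta 4 → ∀ n N : ℕ, 1 ≤ n → (n : ℝ) ^ α ≤ N →
        (β = criticalBeta 4 ∨ (0 < β ∧ (N : ℝ) * invCorrLength (twoPointPlus 4 β) ≤ 1)) →
        c₁ * Real.log ((N : ℝ) / n) - C₁ ≤
          #((Finset.range (N + 1)).filter fun k =>
              n ≤ 2 ^ k ∧ 2 ^ k ≤ N ∧ IsRegularScale (twoPointFree 4 β) c₀ C₀ (2 ^ k)) := by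
  -- the constants
  obtain ⟨C56, hC56, H56⟩ := slidingScale_twoPointFree_four
  obtain ⟨CIR, hCIR, HIR⟩ := boxSusceptibility_le_sq_four
  set θ : ℝ := Real.exp (-2) / (32 * criticalBeta 4) with hθ
  set βmin : ℝ := Real.exp (-2) / 2592 with hβmin
  have hβc0 : 0 < criticalBeta 4 := criticalBeta_pos_holds (d := 4) (by norm_num)
  have hθ0 : 0 < θ := by rw [hθ]; positivity
  have hβmin0 : 0 < βmin := by rw [hβmin]; positivity
  set K : ℝ := C56 / βmin with hK
  have hK0 : 0 < K := div_pos hC56 hβmin0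
  set D : ℝ := 4 * K + 2 with hD
  have hD1 : 1 ≤ D := by rw [hD]; linarith
  have hlD : 0 < Real.log D := Real.log_pos (by rw [hD]; linarith)
  set η : ℝ := (α - 2) / (α - 1) with hη
  have hη0 : 0 < η := by rw [hη]; exact div_pos (by linarith) (by linarith)
  obtain ⟨J, hJ1, hJη⟩ : ∃ J : ℕ, 1 ≤ J ∧ 2 / η ≤ (J : ℝ) :=
    ⟨⌈2 / η⌉₊ + 1, by omega, by push_cast; exact (Nat.le_ceil _).trans (by linarith)⟩
  set r : ℕ := 32 * 2 ^ J with hr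
  have hr32 : 32 ≤ r := by rw [hr]; exact Nat.le_mul_of_pos_right _ (Nat.one_le_two_pow)
  obtain ⟨R, hR1, hRge⟩ : ∃ R : ℕ, 1 ≤ R ∧ 81 * K * (r : ℝ) ^ 4 / 8 ≤ (R : ℝ) :=
    ⟨⌈81 * K * (r : ℝ) ^ 4 / 8⌉₊ + 1, by omega, by push_cast; exact (Nat.le_ceil _).trans (by linarith)⟩
  have hRK : 81 * K * (r : ℝ) ^ 4 ≤ 8 * (R : ℝ) ^ 2 := by
    have h1 := hRge
    have hR' : (1 : ℝ) ≤ R := by exact_mod_cast hR1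
    rw [div_le_iff₀ (by norm_num : (0 : ℝ) < 8)] at h1
    have hRR : (R : ℝ) ≤ (R : ℝ) ^ 2 := le_self_pow₀ hR' two_ne_zero
    linarith
  set c₀ : ℝ := 1 / (2 * (r : ℝ) ^ 4) with hc₀
  set C₀ : ℝ := max (256 * (64 * (r : ℝ)) ^ 4) (4 * R) with hC₀
  have hJlD : 0 < (J : ℝ) * Real.log D := mul_pos (by exact_mod_cast hJ1) hlD
  set c₁ : ℝ := η / 2 / ((J : ℝ) * Real.log D) with hc₁
  have hc₁0 : 0 < c₁ := by rw [hc₁]; positivity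
  set A : ℝ := Real.log θ - Real.log CIR with hA
  have hl2 : 0 < Real.log 2 := Real.log_pos one_lt_two
  set M : ℝ := (J : ℝ) * Real.log D with hM
  set xA : ℝ := ((J : ℝ) + 25) * Real.log 2 - A with hxA
  set C₁ : ℝ := |xA| / M + 13 * c₁ * Real.log 2 with hC₁
  have hC₁0 : 0 ≤ C₁ := by rw [hC₁]; positivity
  have hC₁a : xA ≤ C₁ * M := by
    calc xA ≤ |xA| := le_abs_self xA
      _ = |xA| / M * M := (div_mul_cancel₀ _ hJlD.ne').symm
      _ ≤ |xA| / M * M + 13 * c₁ * Real.log 2 * M := le_add_of_nonneg_right (by positivity)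
      _ = C₁ * M := by rw [hC₁]; ring
  have hC₁b : 13 * c₁ * Real.log 2 ≤ C₁ := by
    rw [hC₁]; exact le_add_of_nonneg_left (by positivity)
  refine ⟨c₀, C₀, c₁, C₁, by rw [hc₀]; positivity, lt_max_of_lt_right (by positivity), hc₁0, ?_⟩
  intro β hβ hβc n N hn hnN hwin
  set S := twoPointFree 4 β with hS
  set χ : ℕ → ℝ := fun t => boxSusceptibility S (t : ℝ) with hχ
  have hS0 : ∀ x, 0 ≤ S x := twoPointFree_nonneg_of_nonneg hβ.le
  have hχpos : ∀ t, 0 < χ t := boxSusceptibility_twoPointFree_pos hβ.le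
  have hχmono : Monotone χ := fun a b hab => boxSusceptibility_mono hS0 (by exact_mod_cast hab)
  set T := (Finset.range (N + 1)).filter fun k =>
      n ≤ 2 ^ k ∧ 2 ^ k ≤ N ∧ IsRegularScale (twoPointFree 4 β) c₀ C₀ (2 ^ k) with hT
  have hcard0 : (0 : ℝ) ≤ #T := Nat.cast_nonneg _
  have hn0 : (0 : ℝ) < n := by exact_mod_cast hn
  have hN1 : (1 : ℝ) ≤ N := by
    have : (1 : ℝ) ≤ (n : ℝ) ^ α := Real.one_le_rpow (by exact_mod_cast hn) (by linarith)
    linarith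
  have hNpos : (0 : ℝ) < N := by linarith
  have hlogNn : Real.log ((N : ℝ) / n) = Real.log N - Real.log n := Real.log_div hNpos.ne' hn0.ne'
  -- trivial case `N < 2`
  by_cases hN2 : N < 2
  · have hN1' : (N : ℝ) ≤ 1 := by exact_mod_cast (show N ≤ 1 by omega)
    have hlog : Real.log ((N : ℝ) / n) ≤ 0 := by
      apply Real.log_nonpos (by positivity)
      rw [div_le_one hn0]
      exact hN1'.trans (by exact_mod_cast hn)
    have := mul_le_mul_of_nonneg_left hlog hc₁0.le
    rw [mul_zero] at this
    linarith
  push Not at hN2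
  -- window consequences
  have hposβ : 0 < twoPointPlus 4 β (Pi.single 0 1) := twoPointPlus_single_pos hβ 0
  have hβge : βmin ≤ β := beta_ge_of_window hβ.le hN2 hwin hposβ
  have hm0 := spontaneousMagnetization_eq_zero_of_le_criticalBeta_four hβ.le hβc
  have hKβ : C56 / β ≤ K := div_le_div_of_nonneg_left hC56.le hβmin0 hβge
  have Hβ : ∀ ℓ L : ℝ, 1 ≤ ℓ → ℓ ≤ L →
      boxSusceptibility S L / L ^ 2 ≤ K * (boxSusceptibility S ℓ / ℓ ^ 2) := fun ℓ L hℓ hℓL =>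
    (H56 β hβ hβc ℓ L hℓ hℓL).trans (mul_le_mul_of_nonneg_right hKβ
      (div_nonneg (boxSusceptibility_nonneg hS0 _) (by positivity)))
  have hdouble : ∀ t : ℕ, 1 ≤ t → χ (2 * t) ≤ D * χ t := by
    intro t ht
    have h := boxSusceptibility_mul_le_of_sliding Hβ (R := 2) (by norm_num) ht
    have h0 : 0 ≤ boxSusceptibility S (t : ℝ) := boxSusceptibility_nonneg hS0 _
    simp only [hχ]
    refine h.trans ?_
    rw [hD]; push_cast
    linarith
  -- the scales
  obtain ⟨k₀, hnk₀, hk₀n, hk1⟩ : ∃ k₀ : ℕ, n < 2 ^ k₀ ∧ 2 ^ (k₀ - 1) ≤ n ∧ 1 ≤ k₀ :=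
    ⟨Nat.log 2 n + 1, Nat.lt_pow_succ_log_self one_lt_two n,
      by rw [Nat.add_sub_cancel]; exact Nat.pow_log_le_self 2 (by omega), by omega⟩
  set e₀ : ℕ := k₀ + 11 with he₀
  obtain ⟨L, hLN, hNL⟩ : ∃ L : ℕ, 2 ^ L ≤ N ∧ N < 2 ^ (L + 1) :=
    ⟨Nat.log 2 N, Nat.pow_log_le_self 2 (by omega), Nat.lt_pow_succ_log_self one_lt_two N⟩
  -- trivial case: fewer than `e₀` dyadic scales below `N`
  by_cases hsmall : L < e₀
  · have hNlt : (N : ℝ) < 2 ^ (k₀ + 11) := by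
      have h1 : N < 2 ^ (k₀ + 11) := lt_of_lt_of_le hNL (Nat.pow_le_pow_right two_pos (by omega))
      exact_mod_cast h1
    have hnge : (2 : ℝ) ^ (k₀ - 1) ≤ n := by exact_mod_cast hk₀n
    have hratio : (N : ℝ) / n ≤ 2 ^ 12 := by
      rw [div_le_iff₀ hn0]
      have hsplit : (2 : ℝ) ^ (k₀ + 11) = 2 ^ 12 * 2 ^ (k₀ - 1) := by
        rw [← pow_add]; congr 1; omega
      calc (N : ℝ) ≤ 2 ^ (k₀ + 11) := hNlt.le
        _ = 2 ^ 12 * 2 ^ (k₀ - 1) := hsplit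
        _ ≤ 2 ^ 12 * n := mul_le_mul_of_nonneg_left hnge (by positivity)
    have hlog : Real.log ((N : ℝ) / n) ≤ 13 * Real.log 2 := by
      calc Real.log ((N : ℝ) / n) ≤ Real.log (2 ^ 12) := Real.log_le_log (by positivity) hratio
        _ = 12 * Real.log 2 := by rw [Real.log_pow]; norm_num
        _ ≤ 13 * Real.log 2 := by linarith
    have := mul_le_mul_of_nonneg_left hlog hc₁0.le
    linarith
  push Not at hsmall
  obtain ⟨I, hIJnat, hIJle⟩ : ∃ I : ℕ, L + 1 ≤ I * J + e₀ + J ∧ e₀ + I * J ≤ L := by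
    refine ⟨(L - e₀) / J, ?_, ?_⟩
    · have h1 := Nat.div_add_mod (L - e₀) J
      have h2 := Nat.mod_lt (L - e₀) (show 0 < J by omega)
      have h3 : J * ((L - e₀) / J) = (L - e₀) / J * J := Nat.mul_comm _ _
      omega
    · have := Nat.div_mul_le_self (L - e₀) J
      omega
  -- Part C along the chain `m_i = 2^{k₀ + 6 + iJ}`, `a = 32`
  have hPC := log_growth_le_card_mul_add hχpos hχmono hD1 hdouble (a := 32) (J := J) (by norm_num) (k₀ + 6) I
  set G := (Finset.range I).filter fun i =>
      χ (32 * 2 ^ (k₀ + 6 + i * J)) + χ (2 ^ (k₀ + 6 + i * J)) ≤ χ (32 * 2 ^ (k₀ + 6 + (i + 1) * J)) with hG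
  -- every growth index gives a regular scale `k = k₀ + 6 + iJ`
  have hreg : ∀ i ∈ G, IsRegularScale S c₀ C₀ (2 ^ (k₀ + 6 + i * J)) := by
    intro i hi
    rw [hG, Finset.mem_filter] at hi
    obtain ⟨-, hgrow⟩ := hi
    set q : ℕ := 2 ^ (k₀ + i * J) with hq
    have hq1 : 1 ≤ q := Nat.one_le_two_pow
    have h64 : 2 ^ (k₀ + 6 + i * J) = 64 * q := by
      rw [hq, show k₀ + 6 + i * J = (k₀ + i * J) + 6 by ring, pow_add]; norm_num; ring
    have hrq : 32 * 2 ^ (k₀ + 6 + (i + 1) * J) = r * (64 * q) := by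
      rw [hr, hq, show k₀ + 6 + (i + 1) * J = ((k₀ + i * J) + 6) + J by ring, pow_add, pow_add]
      norm_num; ring
    rw [h64]
    refine isRegularScale_of_growth hβ.le hm0 hq1 hr32 hR1 ?_ hK0.le ?_ hRK
    · simp only [hχ] at hgrow
      rw [h64, hrq] at hgrow
      exact hgrow
    · exact boxSusceptibility_mul_le_of_sliding Hβ hR1 (by omega)
  -- the injection into the counted set
  have hGT : #G ≤ #T := by
    refine Finset.card_le_card_of_injOn (fun i => k₀ + 6 + i * J) (fun i hi => ?_) ?_
    · have hiI : i < I := Finset.mem_range.1 (Finset.mem_filter.1 hi).1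
      have hk : 2 ^ (k₀ + 6 + i * J) ≤ N := by
        refine le_trans (Nat.pow_le_pow_right two_pos ?_) hLN
        have : i * J + J ≤ I * J := by
          have := Nat.mul_le_mul_right J (show i + 1 ≤ I from hiI)
          rwa [Nat.add_mul, one_mul] at this
        omega
      have hklt : k₀ + 6 + i * J < 2 ^ (k₀ + 6 + i * J) := Nat.lt_two_pow_self
      have hk₀le : k₀ ≤ k₀ + 6 + i * J := Nat.le_add_right_of_le (Nat.le_add_right _ _)
      show k₀ + 6 + i * J ∈ T
      rw [hT]
      refine Finset.mem_filter.2 ⟨Finset.mem_range.2 (Nat.lt_succ_of_le (hklt.le.trans hk)), ?_, hk, hreg i hi⟩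
      exact hnk₀.le.trans (Nat.pow_le_pow_right two_pos hk₀le)
    · intro i _ j _ hij
      have hij' : i * J = j * J := Nat.add_left_cancel hij
      exact Nat.eq_of_mul_eq_mul_right (show 0 < J from hJ1) hij'
  -- the lower bound on the growth of `χ` along the chain
  have hpowtop : 32 * 2 ^ (k₀ + 6 + I * J) = 2 ^ (e₀ + I * J) := by
    rw [he₀]; ring
  have hpowbot : 32 * 2 ^ (k₀ + 6) = 2 ^ e₀ := by
    rw [he₀]; ring
  have htop : θ * (2 : ℝ) ^ (e₀ + I * J) ≤ χ (32 * 2 ^ (k₀ + 6 + I * J)) := by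
    have hle : 2 ^ (e₀ + I * J) ≤ N := le_trans (Nat.pow_le_pow_right two_pos hIJle) hLN
    have h := boxSusceptibility_ge_of_window hβ hβc hN2 hwin hle
    simp only [hχ]
    rw [hpowtop]
    push_cast at h ⊢
    exact h
  have hbot : χ (32 * 2 ^ (k₀ + 6)) ≤ CIR * ((2 : ℝ) ^ e₀ + 1) ^ 2 := by
    have h := HIR β hβ.le hβc (2 ^ e₀)
    simp only [hχ]
    rw [hpowbot]
    push_cast at h ⊢
    exact h
  -- logarithms
  have hlogtop : Real.log θ + ((e₀ : ℝ) + I * J) * Real.log 2 ≤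
      Real.log (χ (32 * 2 ^ (k₀ + 6 + I * J))) := by
    have h := Real.log_le_log (by positivity) htop
    rwa [Real.log_mul hθ0.ne' (by positivity), Real.log_pow, Nat.cast_add, Nat.cast_mul] at h
  have hlogbot : Real.log (χ (32 * 2 ^ (k₀ + 6))) ≤ Real.log CIR + 2 * (((e₀ : ℝ) + 1) * Real.log 2) := by
    have h := Real.log_le_log (hχpos _) hbot
    refine h.trans ?_
    rw [Real.log_mul hCIR.ne' (by positivity), Real.log_pow]
    have hp : (1 : ℝ) ≤ 2 ^ e₀ := one_le_pow₀ one_le_two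
    have h2 : Real.log ((2 : ℝ) ^ e₀ + 1) ≤ ((e₀ : ℝ) + 1) * Real.log 2 := by
      calc Real.log ((2 : ℝ) ^ e₀ + 1) ≤ Real.log ((2 : ℝ) ^ (e₀ + 1)) :=
            Real.log_le_log (by positivity)
              (calc (2 : ℝ) ^ e₀ + 1 ≤ 2 ^ e₀ + 2 ^ e₀ := by linarith
                _ = 2 ^ (e₀ + 1) := by ring)
        _ = ((e₀ : ℝ) + 1) * Real.log 2 := by rw [Real.log_pow]; push_cast; ring
    push_cast
    linarith
  -- the pigeonhole in the shape of `count_endgame`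
  have hPC' : ((I : ℝ) * J - I - e₀ - 2) * Real.log 2 + A ≤ (J : ℝ) * Real.log D * #G := by
    have e1 := hPC
    have e2 := hlogtop
    have e3 := hlogbot
    generalize Real.log (χ (32 * 2 ^ (k₀ + 6 + I * J))) = lt at e1 e2
    generalize Real.log (χ (32 * 2 ^ (k₀ + 6))) = lb at e1 e3
    rw [hA]
    linarith
  -- the remaining real inequalities
  have he0 : (e₀ : ℝ) * Real.log 2 ≤ Real.log n + 12 * Real.log 2 := by
    have h1 : Real.log ((2 : ℝ) ^ (k₀ - 1)) ≤ Real.log n :=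
      Real.log_le_log (by positivity) (by exact_mod_cast hk₀n)
    rw [Real.log_pow] at h1
    have hcast : ((k₀ - 1 : ℕ) : ℝ) = (k₀ : ℝ) - 1 := by rw [Nat.cast_sub hk1, Nat.cast_one]
    rw [hcast] at h1
    rw [he₀]; push_cast
    linarith
  have hIJr : (L : ℝ) - e₀ - ((J : ℝ) - 1) ≤ (I : ℝ) * J := by
    have h : ((L + 1 : ℕ) : ℝ) ≤ ((I * J + e₀ + J : ℕ) : ℝ) := by exact_mod_cast hIJnat
    push_cast at h
    linarith
  have hLr : Real.log N - Real.log 2 ≤ (L : ℝ) * Real.log 2 := by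
    have h1 : Real.log (N : ℝ) < Real.log ((2 : ℝ) ^ (L + 1)) :=
      Real.log_lt_log hNpos (by exact_mod_cast hNL)
    rw [Real.log_pow] at h1
    push_cast at h1
    linarith
  have hXY : α * Real.log n ≤ Real.log N := by
    have h1 : Real.log ((n : ℝ) ^ α) ≤ Real.log N := Real.log_le_log (by positivity) hnN
    rwa [Real.log_rpow hn0] at h1
  have hY : 0 ≤ Real.log (n : ℝ) := Real.log_nonneg (by exact_mod_cast hn)
  have hend := count_endgame hα rfl hJη hl2 hY hXY hPC' he0 hIJr hLr
  -- conclude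
  have hGr : (#G : ℝ) ≤ #T := by exact_mod_cast hGT
  rw [hlogNn]
  have key : (η / 2 * (Real.log N - Real.log n) - C₁ * M) / M ≤ #G := by
    rw [div_le_iff₀ hJlD]
    have : η / 2 * (Real.log ↑N - Real.log ↑n) - xA ≤ (J : ℝ) * Real.log D * #G := hend
    rw [hM] at hC₁a ⊢
    linarith
  have heq : c₁ * (Real.log N - Real.log n) - C₁ = (η / 2 * (Real.log N - Real.log n) - C₁ * M) / M := by
    rw [hc₁]; field_simp
  rw [heq]
  exact key.trans hGr


open scoped Classical in
/-- **Existence of a regular scale in a window of scales** (the form used in the proof of ADC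
Prop. 6.1, p. 22: "since we assumed `ℓ_K ≤ ξ(β)`, by Theorem 5.12 there exists `y ∈ Ann(ℓ_{K-1}, ℓ_K)`
in a regular scale", and in Thm 6.4 for the set `𝒦`): for every `α > 2` there are `c₀, C₀ > 0` and
`M₀` such that for `0 < β ≤ β_c`, `n ≥ 1`, `N ≥ n^α`, `N ≥ M₀ n` in the window `N ≤ ξ(β)` there is a
`(c₀, C₀)`-regular scale `k` with `n ≤ 2^k ≤ N`. [cite: AizenmanDuminilCopinAnnals2021, arXiv:1912.07973 Theorem 5.12 (p. 20) and proof of Prop. 6.1 (p. 22)] -/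
theorem exists_regularScale_between {α : ℝ} (hα : 2 < α) :
    ∃ c₀ C₀ M₀ : ℝ, 0 < c₀ ∧ 0 < C₀ ∧
      ∀ β : ℝ, 0 < β → β ≤ criticalBeta 4 → ∀ n N : ℕ, 1 ≤ n → (n : ℝ) ^ α ≤ N → M₀ * n ≤ N →
        (β = criticalBeta 4 ∨ (0 < β ∧ (N : ℝ) * invCorrLength (twoPointPlus 4 β) ≤ 1)) →
        ∃ k : ℕ, n ≤ 2 ^ k ∧ 2 ^ k ≤ N ∧ IsRegularScale (twoPointFree 4 β) c₀ C₀ (2 ^ k) := by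
  obtain ⟨c₀, C₀, c₁, C₁, hc₀, hC₀, hc₁, H⟩ := abundance_of_regularScales hα
  refine ⟨c₀, C₀, Real.exp ((C₁ + 1) / c₁), hc₀, hC₀, fun β hβ hβc n N hn hnN hM hwin => ?_⟩
  have h := H β hβ hβc n N hn hnN hwin
  have hn0 : (0 : ℝ) < n := by exact_mod_cast hn
  have hlog : (C₁ + 1) / c₁ ≤ Real.log ((N : ℝ) / n) := by
    rw [Real.le_log_iff_exp_le (by
      have : 0 < Real.exp ((C₁ + 1) / c₁) * n := by positivity
      exact div_pos (by linarith) hn0)]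
    rwa [le_div_iff₀ hn0]
  have hone : (1 : ℝ) ≤ #((Finset.range (N + 1)).filter fun k =>
      n ≤ 2 ^ k ∧ 2 ^ k ≤ N ∧ IsRegularScale (twoPointFree 4 β) c₀ C₀ (2 ^ k)) := by
    refine le_trans ?_ h
    have h1 := mul_le_mul_of_nonneg_left hlog hc₁.le
    rw [mul_div_cancel₀ _ hc₁.ne'] at h1
    linarith
  have hne : ((Finset.range (N + 1)).filter fun k =>
      n ≤ 2 ^ k ∧ 2 ^ k ≤ N ∧ IsRegularScale (twoPointFree 4 β) c₀ C₀ (2 ^ k)).Nonempty := by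
    rw [← Finset.card_pos]
    exact_mod_cast (show (0 : ℝ) < _ from zero_lt_one.trans_le hone)
  obtain ⟨k, hk⟩ := hne
  rw [Finset.mem_filter] at hk
  exact ⟨k, hk.2⟩

end Count

end Literature.Probability.LatticeModels
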